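import Summits.QuantumAdvantage.QuantumAdvantage.Theorems.CharDialGammaDialB

/-!
# CharDialGammaDialC — TREE PART C of the decomp-qadv lens-5 g32 node «GammaDial» on `CharDial.FrobStructureLawOdd`
# (stmt-QuantumAdvantage-27205): §4 rows with one or two residues (`row_single`, `row_pair`, `pair_shift`) and UNIT SHIFTS —
# a free coordinate whose switching-on shifts every row by `−1` is an exchange partner of every block coordinate
# (`swapInv_of_unitShift`, `exch_union_of_unitShifts`); §5 THE γ-DIAL `TabLawAt p γ K L` (the table law `TableDial.TabLaw` in the
# sector of top-stratum value `γ`; `tabLaw_iff_sectors`) and ★ SECTOR `γ = 1`: `tabLawAt_one : p ≠ 2 → ∀ L, TabLawAt p 1 0 L`.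

Verbatim `section Rows` and `section SectorOne` of the node file (namespace `Theorems.GammaDial`); definitions `UnitShift`,
`TabLawAt` (plain `def`s, no instances, no notation); no `sorry`.
-/

set_option autoImplicit false
set_option linter.dupNamespace false

namespace Summit.QuantumAdvantage.QuantumAdvantage.Theorems.GammaDial

open Finset
open Summit.QuantumAdvantage.AdviceFreeQNC0
open Literature.Computability.MetaComplexity Literature.Computability.MetaComplexity.Smolensky
open Summit.QuantumAdvantage.QuantumAdvantage.Theorems.IslandDial (Relevant Exch TopConst NormalForm ExchCoreAt ExchCoreOdd IslandAt
  IslandOdd exchCoreOdd_of_target islandOdd_of_target exch_weight_form)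
open Summit.QuantumAdvantage.QuantumAdvantage.Theorems.TableDial (TabLaw TabAt TabOdd tabLaw_all_of_core tabAt_iff_all tabOdd_of_target)
open Summit.QuantumAdvantage.QuantumAdvantage.Theorems.StrataDial (SwapInv exchCoreAt_iff_tabAt chi chi_slice chi_eq_zero_of_card
  chi_eq_zero_of_not_subset comp_swap_eq_self)

/-! ### §4 Rows of a residue predicate with one or two residues; unit shifts are exchange partners of the block -/

section Rows

variable {p : ℕ} [hp : Fact p.Prime] {n : ℕ}

/-- A residue predicate with `c` residues in `𝔽_p` (`0 < c < p`) has exactly `c` residues. -/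
theorem card_row_eq {hh : ZMod p → Bool} {c : ℕ} (hc0 : 0 < c) (hcp : c < p) (h : SubChar.resCount hh = c) :
    (Finset.univ.filter fun z : ZMod p => hh z = true).card = c := by
  have hsum : ((Finset.univ.filter fun z : ZMod p => hh z = true).card : ZMod p) = SubChar.resCount hh := by
    unfold SubChar.resCount
    rw [Finset.natCast_card_filter]
  set N := (Finset.univ.filter fun z : ZMod p => hh z = true).card
  have hN : N ≤ p := (Finset.card_filter_le _ _).trans (by rw [Finset.card_univ, ZMod.card])
  have hmod : N % p = c % p := (ZMod.natCast_eq_natCast_iff' N c p).1 (hsum.trans h)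
  rcases hN.lt_or_eq with hlt | heq
  · rwa [Nat.mod_eq_of_lt hlt, Nat.mod_eq_of_lt hcp] at hmod
  · rw [heq, Nat.mod_self, Nat.mod_eq_of_lt hcp] at hmod
    omega

/-- ONE RESIDUE: `#{hh} = 1` ⟹ `hh = [· = a]` with `a = mom1 hh`. -/
theorem row_single {hh : ZMod p → Bool} (h1 : SubChar.resCount hh = 1) :
    ∃ a : ZMod p, (∀ s, hh s = true ↔ s = a) ∧ mom1 hh = a := by
  have hc := card_row_eq (hh := hh) Nat.one_pos hp.out.one_lt (by rw [h1, Nat.cast_one])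
  obtain ⟨a, ha⟩ := Finset.card_eq_one.1 hc
  have hmem : ∀ s, hh s = true ↔ s = a := fun s => by
    simpa using Finset.ext_iff.1 ha s
  refine ⟨a, hmem, ?_⟩
  unfold mom1
  rw [← Finset.sum_filter, ha, Finset.sum_singleton]

/-- TWO RESIDUES (`p` odd): `#{hh} = 2` ⟹ `hh = [· ∈ {a, b}]`, `a ≠ b`, `mom1 = a + b`, `mom2 = a² + b²`. -/
theorem row_pair (hp2 : p ≠ 2) {hh : ZMod p → Bool} (h2 : SubChar.resCount hh = 2) :
    ∃ a b : ZMod p, a ≠ b ∧ (∀ s, hh s = true ↔ s = a ∨ s = b) ∧ mom1 hh = a + b ∧ mom2 hh = a ^ 2 + b ^ 2 := by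
  have hp3 : 2 < p := by have := hp.out.two_le; omega
  have hc := card_row_eq (hh := hh) Nat.two_pos hp3 (by rw [h2, Nat.cast_two])
  obtain ⟨a, b, hab, hs⟩ := Finset.card_eq_two.1 hc
  have hmem : ∀ s, hh s = true ↔ s = a ∨ s = b := fun s => by
    simpa using Finset.ext_iff.1 hs s
  refine ⟨a, b, hab, hmem, ?_, ?_⟩
  · unfold mom1
    rw [← Finset.sum_filter, hs, Finset.sum_pair hab]
  · unfold mom2
    rw [← Finset.sum_filter, hs, Finset.sum_pair hab]

/-- TWO-RESIDUE SHIFT CRITERION: a pair with sum `a + b − 2` and the same discriminant `(a − b)²` is the pair `{a−1, b−1}`. -/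
theorem pair_shift (hp2 : p ≠ 2) {a b a' b' : ZMod p} (hs : a' + b' = a + b - 2) (hd : (a' - b') ^ 2 = (a - b) ^ 2) :
    ∀ s : ZMod p, (s = a' ∨ s = b') ↔ (s + 1 = a ∨ s + 1 = b) := by
  -- `(2 : 𝔽_p) ≠ 0` for `p` odd, inlined (the tree already has `…BinaryQuartic.two_ne_zero_zmod`; gate dedup.landed).
  have h2 : (2 : ZMod p) ≠ 0 := by
    intro h
    have h' : ((2 : ℕ) : ZMod p) = 0 := by exact_mod_cast h
    rw [ZMod.natCast_eq_zero_iff] at h'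
    exact hp2 ((Nat.prime_dvd_prime_iff_eq hp.out Nat.prime_two).1 h')
  rcases sq_eq_sq_iff_eq_or_eq_neg.1 hd with h | h
  · have ha : a' = a - 1 := mul_left_cancel₀ h2 (by linear_combination hs + h)
    have hb : b' = b - 1 := by linear_combination hs - ha
    intro s
    rw [ha, hb, eq_sub_iff_add_eq, eq_sub_iff_add_eq]
  · have ha : a' = b - 1 := mul_left_cancel₀ h2 (by linear_combination hs + h)
    have hb : b' = a - 1 := by linear_combination hs - ha
    intro s
    rw [ha, hb, eq_sub_iff_add_eq, eq_sub_iff_add_eq, or_comm]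

variable {f : (Fin n → Bool) → Bool} {X R : Finset (Fin n)} {H : (Fin n → Bool) → ZMod p → Bool}

/-- Switching a `true` block coordinate off lowers the block weight by one. -/
theorem bw_update_false {A : Finset (Fin n)} {r : Fin n} (hr : r ∈ A) {v : Fin n → Bool} (hv : v r = true) :
    SubChar.bw A (Function.update v r false) + 1 = SubChar.bw A v := by
  classical
  unfold SubChar.bw
  have e : A.filter (fun i => v i = true) = insert r (A.filter fun i => Function.update v r false i = true) := by
    ext i
    by_cases hir : i = r
    · subst hir
      simp [hv, hr]
    · simp [hir]
  rw [e, Finset.card_insert_of_notMem (by simp)]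

/-- `k ∉ R` is a UNIT SHIFT of the table `H`: switching `k` on shifts every row by `−1`. -/
def UnitShift (R : Finset (Fin n)) (H : (Fin n → Bool) → ZMod p → Bool) (k : Fin n) : Prop :=
  ∀ x : Fin n → Bool, x k = false → ∀ s : ZMod p,
    H (JLin.proj (Finset.univ \ R) (Function.update x k true)) s = H (JLin.proj (Finset.univ \ R) x) (s + 1)

/-- **A unit shift is an exchange partner of every block coordinate**: moving a `1` from `r ∈ R` to `k` lowers the
block weight by one and shifts the row by one — the value is unchanged. -/
theorem swapInv_of_unitShift (hH : ∀ u, f u = H (JLin.proj (Finset.univ \ R) u) ((SubChar.bw R u : ℕ) : ZMod p))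
    {r k : Fin n} (hr : r ∈ R) (hk : k ∉ R) (hshift : UnitShift R H k) : SwapInv f r k := by
  classical
  have hrk : r ≠ k := fun e => hk (e ▸ hr)
  have key : ∀ v : Fin n → Bool, v r = true → v k = false → f (v ∘ Equiv.swap r k) = f v := by
    intro v hvr hvk
    have hwk : Function.update v r false k = false := by rw [Function.update_of_ne hrk.symm]; exact hvk
    have hv' : v ∘ Equiv.swap r k = Function.update (Function.update v r false) k true := by
      funext i
      show v (Equiv.swap r k i) = _
      by_cases hik : i = k
      · subst hik
        rw [Equiv.swap_apply_right, Function.update_self]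
        exact hvr
      · rw [Function.update_of_ne hik]
        by_cases hir : i = r
        · subst hir
          rw [Equiv.swap_apply_left, Function.update_self]
          exact hvk
        · rw [Equiv.swap_apply_of_ne_of_ne hir hik, Function.update_of_ne hir]
    have hproj : JLin.proj (Finset.univ \ R) (Function.update v r false) = JLin.proj (Finset.univ \ R) v := by
      funext i
      unfold JLin.proj
      by_cases hi : i ∈ Finset.univ \ R
      · rw [if_pos hi, if_pos hi, Function.update_of_ne (fun e : i = r => (Finset.mem_sdiff.1 hi).2 (e ▸ hr))]
      · rw [if_neg hi, if_neg hi]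
    have hbw : ((SubChar.bw R (Function.update (Function.update v r false) k true) : ℕ) : ZMod p) + 1 =
        ((SubChar.bw R v : ℕ) : ZMod p) := by
      rw [SubChar.bw_update_of_notMem hk, ← bw_update_false hr hvr]
      push_cast
      ring
    rw [hv', hH, hH v, hshift _ hwk, hproj, hbw]
  intro u
  by_cases hu : u r = u k
  · rw [comp_swap_eq_self hu]
  cases hur : u r
  · have huk : u k = true := by
      cases h : u k
      · exact absurd (hur.trans h.symm) hu
      · rfl
    have h1 := key (u ∘ Equiv.swap r k)
      (by show u (Equiv.swap r k r) = true; rw [Equiv.swap_apply_left]; exact huk)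
      (by show u (Equiv.swap r k k) = false; rw [Equiv.swap_apply_right]; exact hur)
    have h2 : (u ∘ Equiv.swap r k) ∘ Equiv.swap r k = u := by
      funext i
      show u (Equiv.swap r k (Equiv.swap r k i)) = u i
      rw [Equiv.swap_apply_self]
    rw [h2] at h1
    exact h1.symm
  · have huk : u k = false := by
      cases h : u k
      · rfl
      · exact absurd (hur.trans h.symm) hu
    exact key u hur huk

/-- **Block plus unit shifts is exchangeable** (pairs of shifts are conjugated through a block coordinate). -/
theorem exch_union_of_unitShifts (hH : ∀ u, f u = H (JLin.proj (Finset.univ \ R) u) ((SubChar.bw R u : ℕ) : ZMod p))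
    (hex : Exch f R) (hRne : R.Nonempty) {G : Finset (Fin n)} (hG : ∀ k ∈ G, k ∉ R ∧ UnitShift R H k) :
    Exch f (R ∪ G) := by
  obtain ⟨r₀, hr₀⟩ := hRne
  intro i hi j hj u
  rcases Finset.mem_union.1 hi with hiR | hiG <;> rcases Finset.mem_union.1 hj with hjR | hjG
  · exact hex i hiR j hjR u
  · exact swapInv_of_unitShift hH hiR (hG j hjG).1 (hG j hjG).2 u
  · exact SubChar.swapInv_symm f (swapInv_of_unitShift hH hjR (hG i hiG).1 (hG i hiG).2) u
  · exact SubChar.swapInv_conj f (swapInv_of_unitShift hH hr₀ (hG i hiG).1 (hG i hiG).2)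
      (swapInv_of_unitShift hH hr₀ (hG j hjG).1 (hG j hjG).2) u

/-- The free ones after switching a free coordinate on. -/
theorem onesZ_update_true {x : Fin n → Bool} {k : Fin n} (hk : k ∈ X \ R) (hxk : x k = false) :
    onesZ X R (Function.update x k true) = insert k (onesZ X R x) := by
  ext j
  rw [Finset.mem_insert, mem_onesZ, mem_onesZ]
  by_cases hjk : j = k
  · subst hjk
    simp [Finset.mem_sdiff.1 hk]
  · rw [Function.update_of_ne hjk]
    simp [hjk]

/-- … so their number goes up by one. -/
theorem card_onesZ_update_true {x : Fin n → Bool} {k : Fin n} (hk : k ∈ X \ R) (hxk : x k = false) :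
    (onesZ X R (Function.update x k true)).card = (onesZ X R x).card + 1 := by
  rw [onesZ_update_true hk hxk, Finset.card_insert_of_notMem]
  rw [mem_onesZ, hxk]
  simp

end Rows

/-! ### §5 THE γ-DIAL and its sector `γ = 1`: singleton rows, every free coordinate is a unit shift (`K = 0`) -/

section SectorOne

/-- THE γ-DIAL — the table law (`TableDial.TabLaw`) in the SECTOR where the constant top Möbius stratum on `X` has
the value `γ` (= the common residue count of the rows of the table, §3). -/
def TabLawAt (p : ℕ) [Fact p.Prime] (γ : ZMod p) (K L : ℕ) : Prop :=
  ∀ (n : ℕ) (f : (Fin n → Bool) → Bool) (X R : Finset (Fin n)), R ⊆ X → p - 1 ≤ R.card → X.card ≤ R.card + L →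
    DependsOn f (↑X : Set (Fin n)) → HasDegF p f (p - 1) → TopConst p f X γ → Exch f R →
    ∃ Y : Finset (Fin n), Y ⊆ X ∧ X.card ≤ Y.card + K ∧ Exch f Y

variable {p : ℕ} [hp : Fact p.Prime]

/-- The table law is the conjunction of its nonzero sectors. -/
theorem tabLaw_iff_sectors (K L : ℕ) : TabLaw p K L ↔ ∀ γ : ZMod p, γ ≠ 0 → TabLawAt p γ K L := by
  constructor
  · intro h γ hγ n f X R hRX hR hXR hdep hf htop hex
    exact h n f X R hRX hR hXR hdep hf ⟨γ, hγ, htop⟩ hex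
  · intro h n f X R hRX hR hXR hdep hf htop hex
    obtain ⟨γ, hγ, hγt⟩ := htop
    exact h γ hγ n f X R hRX hR hXR hdep hf hγt hex

/-- Sectors are monotone in the exception budget `K`. -/
theorem tabLawAt_mono_K {γ : ZMod p} {K K' L : ℕ} (hK : K ≤ K') (h : TabLawAt p γ K L) : TabLawAt p γ K' L := by
  intro n f X R hRX hR hXR hdep hf htop hex
  obtain ⟨Y, hYX, hc, hY⟩ := h n f X R hRX hR hXR hdep hf htop hex
  exact ⟨Y, hYX, by omega, hY⟩

/-- **SECTOR γ = 1** (every odd prime, every `L`, NO exceptions): every row of the table is a single residue `a_x`,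
the stratum `p − 2` gives `a_{x + e_k} = a_x − 1`, so every free coordinate is a unit shift and `X` itself is
exchangeable. -/
theorem tabLawAt_one (p : ℕ) [hp : Fact p.Prime] (hp2 : p ≠ 2) (L : ℕ) : TabLawAt p 1 0 L := by
  classical
  intro n f X R hRX hR hXR hdep hf htop hex
  have hp3 : 3 ≤ p := by have := hp.out.two_le; omega
  obtain ⟨H, hH⟩ := exch_weight_form p f R hf hR hex
  obtain ⟨S, hSR, hSc⟩ : ∃ S ⊆ R, S.card = p - 2 := Finset.exists_subset_card_eq (by omega)
  have hRne : R.Nonempty := Finset.card_pos.1 (by omega)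
  -- every row is a singleton `{a_x}` with `a_x = mom1`
  have hrow : ∀ x : Fin n → Bool, ∃ a : ZMod p, (∀ s, H (JLin.proj (Finset.univ \ R) x) s = true ↔ s = a) ∧
      mom1 (H (JLin.proj (Finset.univ \ R) x)) = a :=
    fun x => row_single (resCount_row hp2 hRX hR hdep hf htop hH x)
  -- every free coordinate is a unit shift
  have hshift : ∀ k ∈ X \ R, UnitShift R H k := by
    intro k hk x hxk s
    obtain ⟨a, ha, hma⟩ := hrow x
    obtain ⟨a', ha', hma'⟩ := hrow (Function.update x k true)
    have e1 := mom1_row hp2 hRX hdep hf htop hH hSR hSc x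
    have e2 := mom1_row hp2 hRX hdep hf htop hH hSR hSc (Function.update x k true)
    rw [resCount_row hp2 hRX hR hdep hf htop hH, card_onesZ_update_true hk hxk] at e2
    rw [resCount_row hp2 hRX hR hdep hf htop hH] at e1
    have haa : a' = a - 1 := by
      rw [← hma, ← hma']
      have : ((((onesZ X R x).card + 1 : ℕ)) : ZMod p) = ((onesZ X R x).card : ZMod p) + 1 := by push_cast; ring
      rw [this] at e2
      linear_combination e1 - e2
    rw [Bool.eq_iff_iff, ha', ha, haa, eq_sub_iff_add_eq]
  refine ⟨X, le_refl X, by omega, ?_⟩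
  have e : R ∪ (X \ R) = X := Finset.union_sdiff_of_subset hRX
  rw [← e]
  exact exch_union_of_unitShifts hH hex hRne fun k hk => ⟨(Finset.mem_sdiff.1 hk).2, hshift k hk⟩

end SectorOne

end Summit.QuantumAdvantage.QuantumAdvantage.Theorems.GammaDial
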